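import Literature.Analysis.TotalPositivity.PolyaFrequencyFunctionsProofs
import Mathlib.MeasureTheory.Integral.IntervalIntegral.Basic
import Mathlib.MeasureTheory.Integral.ExpDecay
import Mathlib.Analysis.SpecialFunctions.ImproperIntegrals
import Mathlib.Analysis.SpecialFunctions.Log.Basic
import HarnessLib

/-!
# Pólya frequency functions: boundedness and exponential decay (Schoenberg 1951, necessity
half, first step)

Trunk `Literature/Analysis/TotalPositivity`, eighth proofs file accompanying
`PolyaFrequencyFunctions.lean` (the named fact `schoenberg1951_pf_laplace`); first step of the
NECESSITY half: a Pólya frequency function `Λ` decays exponentially at `±∞`, so that its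
bilateral Laplace transform converges absolutely on a strip `|Re s| < η` about the imaginary axis
[Schoenberg1951, §5; SchoenbergWhitney1953, Introduction: "the Laplace transform of a Pólya
frequency function converges in a vertical strip containing the origin"].

Only the `2 × 2` determinants (`PF₂`) and `0 < ∫Λ < ∞` are used, and no appeal to the regularity
theory of measurable mid-concave functions is needed:

* `PF₂` reads `Λ(a)Λ(p + q − a) ≥ Λ(p)Λ(q)` for `p < a < q` (`IsPolyaFrequencyFun.pf2_ineq`);
  hence `{Λ > 0}` is an interval and, integrating the AM–GM inequality over `(p, q)`,
  `Λ(p)Λ(q) ≤ (∫Λ/(q − p))²` (`mul_le_sq_div`), so `Λ` is BOUNDED (`exists_bound`);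
* the ratios `Λ(p + t)/Λ(p)` decrease in `p` (`ratio_le`); if they were `≥ 1` for all large `p`
  the integral would diverge, so some ratio is `< 1` and iteration gives geometric, i.e.
  exponential, decay to the right (`exists_exp_decay_right`); the left side follows by
  reflection (`exists_exp_decay`), and the strip of absolute convergence
  (`integrable_exp_mul`) results.

## References

* I. J. Schoenberg, *On Pólya frequency functions. I*, J. Analyse Math. 1 (1951) 331–374, §5
  (Lemma: the strip of convergence). [Schoenberg1951]
* I. J. Schoenberg, A. Whitney, *On Pólya frequency functions. III*, Trans. AMS 74 (1953),
  Introduction p. 247 ("for `n = 2`, (2) is equivalent to the convexity of `−log Λ`").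
  [SchoenbergWhitney1953]
* S. Karlin, *Total Positivity* I (1968), Ch. 7 §1 (PF₂ ⇔ log-concavity; exponential tails).
  [Karlin1968]
-/

noncomputable section

open MeasureTheory Set Filter
open scoped Topology

namespace Literature.Analysis.TotalPositivity

variable {Λ : ℝ → ℝ}

/-! ### `PF₂` -/

/-- A pair `a < b` as a strictly increasing `Fin 2`-tuple. [folklore] -/
theorem strictMono_vecTwo {a b : ℝ} (hab : a < b) : StrictMono ![a, b] := by
  intro i j hij
  fin_cases i <;> fin_cases j
  · exact absurd hij (lt_irrefl _)
  · simpa using hab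
  · exact absurd hij (by decide)
  · exact absurd hij (lt_irrefl _)

/-- **The `2 × 2` condition**: `Λ(p)Λ(q) ≤ Λ(a)Λ(p + q − a)` for `p < a < q` — the translation
determinant at the nodes `x = (0, q − a)`, `y = (−a, −p)`.
[cite: SchoenbergWhitney1953, Introduction ("for n = 2 …")] [cite: Karlin1968, Ch. 7 §1] -/
theorem IsPolyaFrequencyFun.pf2_ineq (h : IsPolyaFrequencyFun Λ) {p a q : ℝ} (hpa : p < a)
    (haq : a < q) : Λ p * Λ q ≤ Λ a * Λ (p + q - a) := by
  have hx : StrictMono ![(0 : ℝ), q - a] := strictMono_vecTwo (by linarith)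
  have hy : StrictMono ![-a, -p] := strictMono_vecTwo (by linarith)
  have hdet := h.minor_nonneg hx hy
  unfold translationMinor at hdet
  rw [Matrix.det_fin_two] at hdet
  simp only [Matrix.of_apply, Matrix.cons_val_zero, Matrix.cons_val_one, sub_neg_eq_add,
    zero_add, sub_add_cancel] at hdet
  have h1 : q - a + p = p + q - a := by ring
  rw [h1] at hdet
  linarith [mul_comm (Λ q) (Λ p)]

/-- **`{Λ > 0}` is an interval.** [cite: Karlin1968, Ch. 7 §1] [folklore] -/
theorem IsPolyaFrequencyFun.pos_of_between (h : IsPolyaFrequencyFun Λ) {p a q : ℝ}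
    (hp : 0 < Λ p) (hq : 0 < Λ q) (hpa : p < a) (haq : a < q) : 0 < Λ a := by
  have h1 := h.pf2_ineq hpa haq
  have h2 : 0 < Λ a * Λ (p + q - a) := lt_of_lt_of_le (mul_pos hp hq) h1
  by_contra hle
  push Not at hle
  have h3 : Λ a = 0 := le_antisymm hle (h.nonneg a)
  rw [h3, zero_mul] at h2
  exact lt_irrefl 0 h2

/-- **The ratios decrease**: `Λ(p)Λ(p' + t) ≤ Λ(p + t)Λ(p')` for `p ≤ p'`, `t > 0`
(`Λ(p' + t)/Λ(p') ≤ Λ(p + t)/Λ(p)`). [cite: Karlin1968, Ch. 7 §1] [folklore] -/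
theorem IsPolyaFrequencyFun.ratio_le (h : IsPolyaFrequencyFun Λ) {p p' t : ℝ} (hpp' : p ≤ p')
    (ht : 0 < t) : Λ p * Λ (p' + t) ≤ Λ (p + t) * Λ p' := by
  rcases eq_or_lt_of_le hpp' with rfl | hlt
  · rw [mul_comm]
  · have := h.pf2_ineq (p := p) (a := p + t) (q := p' + t) (by linarith) (by linarith)
    have h1 : p + (p' + t) - (p + t) = p' := by ring
    rwa [h1] at this

/-! ### Boundedness -/

/-- **The basic bound** `Λ(p)Λ(q) ≤ (∫Λ/(q − p))²` for `p < q`: integrate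
`2√(Λ(p)Λ(q)) ≤ 2√(Λ(a)Λ(p+q−a)) ≤ Λ(a) + Λ(p + q − a)` over `a ∈ (p, q)`.
[cite: Schoenberg1951, §5] [folklore] -/
theorem IsPolyaFrequencyFun.mul_le_sq_div (h : IsPolyaFrequencyFun Λ) {p q : ℝ} (hpq : p < q) :
    Λ p * Λ q ≤ ((∫ x, Λ x) / (q - p)) ^ 2 := by
  set m := Real.sqrt (Λ p * Λ q) with hm
  have hm0 : 0 ≤ m := Real.sqrt_nonneg _
  have hmsq : m ^ 2 = Λ p * Λ q := Real.sq_sqrt (mul_nonneg (h.nonneg p) (h.nonneg q))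
  -- pointwise AM–GM on `[p, q]`
  have hpt : ∀ a ∈ Icc p q, 2 * m ≤ Λ a + Λ (p + q - a) := by
    intro a ha
    have hprod : Λ p * Λ q ≤ Λ a * Λ (p + q - a) := by
      rcases eq_or_lt_of_le ha.1 with rfl | hpa
      · simp
      rcases eq_or_lt_of_le ha.2 with rfl | haq
      · have : p + a - a = p := by ring
        rw [this, mul_comm]
      exact h.pf2_ineq hpa haq
    have hsq : Real.sqrt (Λ p * Λ q) ≤ Real.sqrt (Λ a * Λ (p + q - a)) := Real.sqrt_le_sqrt hprod
    have hamgm : 2 * Real.sqrt (Λ a * Λ (p + q - a)) ≤ Λ a + Λ (p + q - a) := by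
      have h1 := h.nonneg a
      have h2 := h.nonneg (p + q - a)
      rw [Real.sqrt_mul h1]
      nlinarith [sq_nonneg (Real.sqrt (Λ a) - Real.sqrt (Λ (p + q - a))), Real.sq_sqrt h1,
        Real.sq_sqrt h2, Real.sqrt_nonneg (Λ a), Real.sqrt_nonneg (Λ (p + q - a))]
    linarith
  -- integrate over `p..q`
  have hint : IntervalIntegrable Λ volume p q := h.integrable.intervalIntegrable
  have hint' : IntervalIntegrable (fun a => Λ (p + q - a)) volume p q :=
    (h.integrable.comp_sub_left (p + q)).intervalIntegrable
  have hI1 : ∫ a in p..q, (2 * m) ≤ ∫ a in p..q, (Λ a + Λ (p + q - a)) :=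
    intervalIntegral.integral_mono_on hpq.le (by simp) (hint.add hint') hpt
  have hI2 : ∫ a in p..q, (Λ a + Λ (p + q - a)) = 2 * ∫ a in p..q, Λ a := by
    rw [intervalIntegral.integral_add hint hint', intervalIntegral.integral_comp_sub_left]
    have h1 : p + q - q = p := by ring
    have h2 : p + q - p = q := by ring
    rw [h1, h2]
    ring
  have hI3 : ∫ a in p..q, Λ a ≤ ∫ x, Λ x := by
    rw [intervalIntegral.integral_of_le hpq.le]
    exact setIntegral_le_integral h.integrable (Eventually.of_forall h.nonneg)
  rw [intervalIntegral.integral_const, smul_eq_mul] at hI1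
  have hkey : m ≤ (∫ x, Λ x) / (q - p) := by
    rw [le_div_iff₀ (sub_pos.2 hpq)]
    nlinarith
  calc Λ p * Λ q = m ^ 2 := hmsq.symm
    _ ≤ ((∫ x, Λ x) / (q - p)) ^ 2 := pow_le_pow_left₀ hm0 hkey 2

/-- A Pólya frequency function is positive at two distinct points (its support has positive
measure). [folklore] -/
theorem IsPolyaFrequencyFun.exists_two_pos (h : IsPolyaFrequencyFun Λ) :
    ∃ p q : ℝ, p < q ∧ 0 < Λ p ∧ 0 < Λ q := by
  by_contra hcon
  push Not at hcon
  have hsub : (Function.support Λ).Subsingleton := by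
    intro x hx y hy
    rw [Function.mem_support] at hx hy
    have hx' : 0 < Λ x := lt_of_le_of_ne (h.nonneg x) (Ne.symm hx)
    have hy' : 0 < Λ y := lt_of_le_of_ne (h.nonneg y) (Ne.symm hy)
    by_contra hxy
    rcases lt_or_gt_of_ne hxy with hlt | hlt
    · exact absurd hy' (not_lt.2 (hcon x y hlt hx'))
    · exact absurd hx' (not_lt.2 (hcon y x hlt hy'))
  have hpos := h.integral_pos
  rw [integral_pos_iff_support_of_nonneg_ae (Eventually.of_forall h.nonneg) h.integrable] at hpos
  rw [hsub.measure_zero volume] at hpos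
  exact lt_irrefl _ hpos

/-- **A Pólya frequency function is bounded.** [cite: Schoenberg1951, §5] [folklore] -/
theorem IsPolyaFrequencyFun.exists_bound (h : IsPolyaFrequencyFun Λ) : ∃ M : ℝ, ∀ x, Λ x ≤ M := by
  obtain ⟨p, q, hpq, hp, hq⟩ := h.exists_two_pos
  set I := ∫ x, Λ x with hI
  set K := (I / ((q - p) / 2)) ^ 2 with hK
  refine ⟨K / Λ p + K / Λ q, fun x => ?_⟩
  have hK0 : 0 ≤ K := sq_nonneg _
  have hKp : 0 ≤ K / Λ p := div_nonneg hK0 hp.le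
  have hKq : 0 ≤ K / Λ q := div_nonneg hK0 hq.le
  rcases le_or_gt x ((p + q) / 2) with hx | hx
  · -- use the point `q` to the right
    have hxq : x < q := by linarith
    have h1 := h.mul_le_sq_div hxq
    have h2 : (I / (q - x)) ^ 2 ≤ K := by
      rw [hK]
      have hqx : (q - p) / 2 ≤ q - x := by linarith
      have hI0 : 0 ≤ I := (h.integral_pos).le
      exact pow_le_pow_left₀ (div_nonneg hI0 (by linarith)) (div_le_div_of_nonneg_left hI0
        (by linarith) hqx) 2
    have h3 : Λ x * Λ q ≤ K := h1.trans h2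
    have h4 : Λ x ≤ K / Λ q := by
      rw [le_div_iff₀ hq]
      exact h3
    linarith
  · -- use the point `p` to the left
    have hpx : p < x := by linarith
    have h1 := h.mul_le_sq_div hpx
    have h2 : (I / (x - p)) ^ 2 ≤ K := by
      rw [hK]
      have hqx : (q - p) / 2 ≤ x - p := by linarith
      have hI0 : 0 ≤ I := (h.integral_pos).le
      exact pow_le_pow_left₀ (div_nonneg hI0 (by linarith)) (div_le_div_of_nonneg_left hI0
        (by linarith) hqx) 2
    have h3 : Λ p * Λ x ≤ K := h1.trans h2
    have h4 : Λ x ≤ K / Λ p := by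
      rw [le_div_iff₀ hp]
      linarith [mul_comm (Λ p) (Λ x)]
    linarith

/-! ### Exponential decay -/

/-- **Exponential decay to the right**: `Λ(x) ≤ C e^{−ηx}` for `x ≥ 0`, some `η > 0`.
If `Λ` vanishes from some point on this is trivial; otherwise `Λ > 0` on `[q, ∞)`, some ratio
`Λ(p₁ + 1)/Λ(p₁) = r < 1` (else `∫Λ = ∞`), and then `Λ(p + 1) ≤ rΛ(p)` for all `p ≥ p₁`.
[cite: Schoenberg1951, §5] [cite: Karlin1968, Ch. 7 §1] -/
theorem IsPolyaFrequencyFun.exists_exp_decay_right (h : IsPolyaFrequencyFun Λ) :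
    ∃ η : ℝ, 0 < η ∧ ∃ C : ℝ, ∀ x, 0 ≤ x → Λ x ≤ C * Real.exp (-(η * x)) := by
  obtain ⟨M, hM⟩ := h.exists_bound
  have hM0 : 0 ≤ M := (h.nonneg 0).trans (hM 0)
  by_cases hzero : ∃ b : ℝ, ∀ x, b ≤ x → Λ x = 0
  · obtain ⟨b, hb⟩ := hzero
    refine ⟨1, one_pos, M * Real.exp b, fun x _ => ?_⟩
    rcases le_or_gt b x with hbx | hbx
    · rw [hb x hbx]
      positivity
    · calc Λ x ≤ M := hM x
        _ = M * Real.exp b * Real.exp (-(1 * b)) := by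
            rw [mul_assoc, ← Real.exp_add]
            simp
        _ ≤ M * Real.exp b * Real.exp (-(1 * x)) := by
            refine mul_le_mul_of_nonneg_left (Real.exp_le_exp.2 (by linarith)) (by positivity)
  · push Not at hzero
    obtain ⟨p, q, hpq, hp, hq⟩ := h.exists_two_pos
    -- `Λ > 0` on `[q, ∞)`
    have hposq : ∀ x, q ≤ x → 0 < Λ x := by
      intro x hx
      obtain ⟨x', hx', hne⟩ := hzero (x + 1)
      have hx'pos : 0 < Λ x' := lt_of_le_of_ne (h.nonneg x') (Ne.symm hne)
      rcases eq_or_lt_of_le hx with rfl | hlt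
      · exact hq
      · exact h.pos_of_between hp hx'pos (hpq.trans hlt) (by linarith)
    -- some ratio is `< 1`
    have hratio : ∃ p₁, q ≤ p₁ ∧ Λ (p₁ + 1) < Λ p₁ := by
      by_contra hcon
      push Not at hcon
      -- then `Λ(u + k) ≥ Λ(u)` for `u ≥ q`, and the integral diverges
      have hmono : ∀ (k : ℕ) (u : ℝ), q ≤ u → Λ u ≤ Λ (u + k) := by
        intro k
        induction k with
        | zero => intro u _; simp
        | succ k ih =>
          intro u hu
          have h1 := ih u hu
          have h2 := hcon (u + k) (by linarith [(k.cast_nonneg : (0 : ℝ) ≤ k)])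
          push_cast
          have h3 : u + ((k : ℝ) + 1) = u + k + 1 := by ring
          rw [h3]
          linarith
      set c₀ := ∫ x in q..q + 1, Λ x with hc₀
      have hc₀pos : 0 < c₀ :=
        intervalIntegral.intervalIntegral_pos_of_pos_on h.integrable.intervalIntegrable
          (fun x hx => hposq x hx.1.le) (by linarith)
      have hstep : ∀ k : ℕ, c₀ ≤ ∫ x in (q + k)..(q + k + 1), Λ x := by
        intro k
        have h1 : ∫ x in (q + k)..(q + k + 1), Λ x = ∫ x in q..q + 1, Λ (x + k) := by
          rw [intervalIntegral.integral_comp_add_right]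
          congr 1
          ring
        rw [h1]
        exact intervalIntegral.integral_mono_on (by linarith) h.integrable.intervalIntegrable
          (h.integrable.comp_add_right _).intervalIntegrable fun u hu => hmono k u hu.1
      have hsum : ∀ n : ℕ, (n : ℝ) * c₀ ≤ ∫ x, Λ x := by
        intro n
        have h1 : ∑ k ∈ Finset.range n, ∫ x in (q + k)..(q + (k + 1 : ℕ)), Λ x =
            ∫ x in (q + (0 : ℕ))..(q + n), Λ x :=
          intervalIntegral.sum_integral_adjacent_intervals (a := fun k : ℕ => q + k)
            fun k _ => h.integrable.intervalIntegrable
        have h2 : (n : ℝ) * c₀ ≤ ∑ k ∈ Finset.range n, ∫ x in (q + k)..(q + (k + 1 : ℕ)), Λ x := by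
          have : ∀ k ∈ Finset.range n, c₀ ≤ ∫ x in (q + k)..(q + (k + 1 : ℕ)), Λ x := by
            intro k _
            have := hstep k
            push_cast
            rwa [← add_assoc]
          calc (n : ℝ) * c₀ = ∑ _k ∈ Finset.range n, c₀ := by simp
            _ ≤ _ := Finset.sum_le_sum this
        have h3 : ∫ x in (q + (0 : ℕ))..(q + n), Λ x ≤ ∫ x, Λ x := by
          rw [intervalIntegral.integral_of_le (by simp)]
          exact setIntegral_le_integral h.integrable (Eventually.of_forall h.nonneg)
        linarith
      obtain ⟨n, hn⟩ := exists_nat_gt ((∫ x, Λ x) / c₀)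
      have := hsum n
      rw [div_lt_iff₀ hc₀pos] at hn
      linarith
    obtain ⟨p₁, hp₁, hlt⟩ := hratio
    have hp₁pos : 0 < Λ p₁ := hposq p₁ hp₁
    set r := Λ (p₁ + 1) / Λ p₁ with hr
    have hr0 : 0 < r := div_pos (hposq (p₁ + 1) (by linarith)) hp₁pos
    have hr1 : r < 1 := (div_lt_one hp₁pos).2 hlt
    -- `Λ(y + 1) ≤ r Λ(y)` for `y ≥ p₁`, hence `Λ(p₁ + u + k) ≤ r^k M`
    have hstep : ∀ y, p₁ ≤ y → Λ (y + 1) ≤ r * Λ y := by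
      intro y hy
      have h1 := h.ratio_le hy one_pos
      rw [hr, div_mul_eq_mul_div, le_div_iff₀ hp₁pos]
      linarith [mul_comm (Λ (y + 1)) (Λ p₁)]
    have hiter : ∀ (k : ℕ) (u : ℝ), 0 ≤ u → Λ (p₁ + u + k) ≤ r ^ k * M := by
      intro k
      induction k with
      | zero => intro u _; simpa using hM (p₁ + u)
      | succ k ih =>
        intro u hu
        have h1 := hstep (p₁ + u + k) (by linarith [(k.cast_nonneg : (0 : ℝ) ≤ k)])
        have h2 := ih u hu
        push_cast
        calc Λ (p₁ + u + (k + 1)) = Λ (p₁ + u + k + 1) := by ring_nf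
          _ ≤ r * Λ (p₁ + u + k) := h1
          _ ≤ r * (r ^ k * M) := mul_le_mul_of_nonneg_left h2 hr0.le
          _ = r ^ (k + 1) * M := by ring
    set η := -Real.log r with hη
    have hη0 : 0 < η := by
      rw [hη, neg_pos]
      exact Real.log_neg hr0 hr1
    refine ⟨η, hη0, M * Real.exp (η * (p₁ + 1)), fun x hx => ?_⟩
    rcases lt_or_ge x (p₁ + 1) with hx1 | hx1
    · calc Λ x ≤ M := hM x
        _ = M * Real.exp (η * (p₁ + 1)) * Real.exp (-(η * (p₁ + 1))) := by
            rw [mul_assoc, ← Real.exp_add]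
            simp
        _ ≤ M * Real.exp (η * (p₁ + 1)) * Real.exp (-(η * x)) := by
            refine mul_le_mul_of_nonneg_left (Real.exp_le_exp.2 ?_) (by positivity)
            nlinarith
    · -- `x = p₁ + u + k`, `k = ⌊x - p₁⌋ ≥ 1`, `u ∈ [0, 1)`
      set k := ⌊x - p₁⌋₊ with hk
      have hxp : 1 ≤ x - p₁ := by linarith
      have hk1 : (k : ℝ) ≤ x - p₁ := Nat.floor_le (by linarith)
      have hk2 : x - p₁ < k + 1 := Nat.lt_floor_add_one _
      set u := x - p₁ - k with hu
      have hu0 : 0 ≤ u := by rw [hu]; linarith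
      have hmain := hiter k u hu0
      have hxeq : p₁ + u + k = x := by rw [hu]; ring
      rw [hxeq] at hmain
      have hrk : r ^ k ≤ Real.exp (η * (p₁ + 1)) * Real.exp (-(η * x)) := by
        rw [← Real.exp_add, ← Real.rpow_natCast, Real.rpow_def_of_pos hr0, Real.exp_le_exp, hη]
        have hlog : Real.log r < 0 := Real.log_neg hr0 hr1
        nlinarith
      calc Λ x ≤ r ^ k * M := hmain
        _ ≤ Real.exp (η * (p₁ + 1)) * Real.exp (-(η * x)) * M :=
            mul_le_mul_of_nonneg_right hrk hM0
        _ = M * Real.exp (η * (p₁ + 1)) * Real.exp (-(η * x)) := by ring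

/-- **Two-sided exponential decay**: `Λ(x) ≤ C e^{−η|x|}` for some `η > 0`, `C ≥ 0`
(right decay for `Λ` and for its reflection). [cite: Schoenberg1951, §5] -/
theorem IsPolyaFrequencyFun.exists_exp_decay (h : IsPolyaFrequencyFun Λ) :
    ∃ η : ℝ, 0 < η ∧ ∃ C : ℝ, 0 ≤ C ∧ ∀ x, Λ x ≤ C * Real.exp (-(η * |x|)) := by
  obtain ⟨η₁, hη₁, C₁, hC₁⟩ := h.exists_exp_decay_right
  obtain ⟨η₂, hη₂, C₂, hC₂⟩ := h.comp_neg.exists_exp_decay_right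
  have hC₁0 : 0 ≤ C₁ := by simpa using (h.nonneg 0).trans (hC₁ 0 le_rfl)
  have hC₂0 : 0 ≤ C₂ := by simpa using (h.nonneg 0).trans (by simpa using hC₂ 0 le_rfl)
  refine ⟨min η₁ η₂, lt_min hη₁ hη₂, max C₁ C₂, le_max_of_le_left hC₁0, fun x => ?_⟩
  rcases le_or_gt 0 x with hx | hx
  · rw [abs_of_nonneg hx]
    calc Λ x ≤ C₁ * Real.exp (-(η₁ * x)) := hC₁ x hx
      _ ≤ max C₁ C₂ * Real.exp (-(min η₁ η₂ * x)) :=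
          mul_le_mul (le_max_left _ _) (Real.exp_le_exp.2 (by nlinarith [min_le_left η₁ η₂]))
            (Real.exp_pos _).le (le_max_of_le_left hC₁0)
  · rw [abs_of_neg hx]
    have h1 := hC₂ (-x) (by linarith)
    simp only [neg_neg] at h1
    calc Λ x ≤ C₂ * Real.exp (-(η₂ * -x)) := h1
      _ ≤ max C₁ C₂ * Real.exp (-(min η₁ η₂ * -x)) :=
          mul_le_mul (le_max_right _ _) (Real.exp_le_exp.2 (by nlinarith [min_le_right η₁ η₂]))
            (Real.exp_pos _).le (le_max_of_le_left hC₁0)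

/-- `x ↦ e^{−b|x|}` is integrable for `b > 0`. [folklore] -/
theorem integrable_exp_neg_mul_abs {b : ℝ} (hb : 0 < b) :
    Integrable fun x : ℝ => Real.exp (-(b * |x|)) := by
  have h1 : IntegrableOn (fun x : ℝ => Real.exp (-(b * |x|))) (Ioi 0) := by
    refine IntegrableOn.congr_fun (exp_neg_integrableOn_Ioi 0 hb) (fun x hx => ?_) measurableSet_Ioi
    rw [abs_of_pos hx, neg_mul]
  have h2 : IntegrableOn (fun x : ℝ => Real.exp (-(b * |x|))) (Iic 0) := by
    refine IntegrableOn.congr_fun (integrableOn_exp_mul_Iic hb 0) (fun x hx => ?_) measurableSet_Iic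
    rw [abs_of_nonpos hx]
    ring_nf
  have h3 := integrableOn_union.2 ⟨h2, h1⟩
  rwa [Iic_union_Ioi, integrableOn_univ] at h3

/-- **The strip of absolute convergence**: for `|c| < η` (the decay rate) the tilted function
`e^{−cx}Λ(x)` is integrable, i.e. the bilateral Laplace integral `∫ e^{−xs}Λ(x)dx` converges
absolutely for `|Re s| < η`. [cite: Schoenberg1951, §5]
[cite: SchoenbergWhitney1953, Introduction p. 247] -/
theorem IsPolyaFrequencyFun.exists_strip (h : IsPolyaFrequencyFun Λ) :
    ∃ η : ℝ, 0 < η ∧ ∀ c : ℝ, |c| < η → Integrable fun x => Real.exp (-(c * x)) * Λ x := by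
  obtain ⟨η, hη, C, hC0, hC⟩ := h.exists_exp_decay
  refine ⟨η, hη, fun c hc => ?_⟩
  have hb : 0 < η - |c| := by linarith
  refine ((integrable_exp_neg_mul_abs hb).const_mul C).mono' ?_ (Eventually.of_forall fun x => ?_)
  · exact ((Real.continuous_exp.comp (continuous_const.mul continuous_id).neg).measurable.mul
      h.measurable).aestronglyMeasurable
  · rw [Real.norm_eq_abs, abs_mul, abs_of_pos (Real.exp_pos _), abs_of_nonneg (h.nonneg x)]
    calc Real.exp (-(c * x)) * Λ x ≤ Real.exp (-(c * x)) * (C * Real.exp (-(η * |x|))) :=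
          mul_le_mul_of_nonneg_left (hC x) (Real.exp_pos _).le
      _ = C * (Real.exp (-(c * x)) * Real.exp (-(η * |x|))) := by ring
      _ ≤ C * Real.exp (-((η - |c|) * |x|)) := by
          refine mul_le_mul_of_nonneg_left ?_ hC0
          rw [← Real.exp_add, Real.exp_le_exp]
          have : -(c * x) ≤ |c| * |x| := by
            rw [← abs_mul]
            exact neg_le_abs (c * x)
          nlinarith [abs_nonneg x, abs_nonneg c]

end Literature.Analysis.TotalPositivity

end
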